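import Summits.Ventures.HodgeRepro2.T5CyclotomicSevenInertThree
import Summits.Ventures.HodgeRepro2.T5RecordSatakeInertToyDegree

/-!
# Every rational prime `p ≡ 3 (mod 4)` stays prime in `ℚ(i)`, with `N(v) = p`: the inert family of the toy field

Tier-5 support N3 / §G-N4.2 (seat p3, gen 78). The inert place `(3)` of `ℚ(i)` (seat p8's T5-160, by
Kummer–Dedekind) carries the numerals of files 249 / 252 (`q = 3`). File 256's argument for `ℚ(ζ₇)` — the inertia
degree of `p` in `ℚ(ζₘ)` is the order of `p` modulo `m` (Mathlib) — applies verbatim with `m = 4`: every rational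
prime `p` with `orderOf (p : ZMod 4) = 2`, i.e. `p ≡ 3 (mod 4)` (`3, 7, 11, 19, 23, …`), has `(p)` prime in
`𝓞_{ℚ(i)}` of norm `p²`, and the place `(p)` of `ℚ(i)⁺` stays prime with `N(v) = p`:

* `not_dvd_four_of_orderOf_eq_two` — such a `p` is odd;
* `absNorm_of_liesOver_of_orderOf_eq_two` — every prime of `𝓞_{ℚ(i)}` above `p` has norm `p²`;
* **`isPrime_span_natCast_of_orderOf_eq_two`**, **`prime_natCast_of_orderOf_eq_two`** — `(p)` is a prime of
  `𝓞_{ℚ(i)}`;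
* `wPrime`, `vPrime`, `liesOver_vPrime`, **`map_vPrime`** — the places `(p)` of `ℚ(i)` and of `ℚ(i)⁺`, and
  «`v 𝓞_K = w`»; **`absNorm_vPrime`** — `N(v) = p`;
* the instances `p = 3` (`isPrime_span_three`, p8's T5-160 re-derived) and `p = 7` (`isPrime_span_seven`,
  `absNorm_vPrime_seven`).

§8(d): uses an L-value-free non-vanishing device: NO.
-/

open NumberField NumberField.IsCMField IsDedekindDomain IsDedekindDomain.HeightOneSpectrum Module Polynomial
open Summit.Ventures.HodgeRepro2.T5RecordSatakeInert Summit.Ventures.HodgeRepro2.T5InertDegreeAdicCompletion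
  Summit.Ventures.HodgeRepro2.T5FinitePlaceSplitIff Summit.Ventures.HodgeRepro2.T5InertGlobalPrime
  Summit.Ventures.HodgeRepro2.T5FinitePlaceCM Summit.Ventures.HodgeRepro2.T5FinitePlaceNormIndex
  Summit.Ventures.HodgeRepro2.T5CMFieldSquareDatum Summit.Ventures.HodgeRepro2.T5NonSplitPlaceUnitaryGroup
  Summit.Ventures.HodgeRepro2.T5CyclotomicSevenInertThree Summit.Ventures.HodgeRepro2.T5RecordSatakeInertToy
  Summit.Ventures.HodgeRepro2.T5CMCensusToy Summit.Ventures.HodgeRepro2.T5RecordSatakeInertToyDegree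

namespace Summit.Ventures.HodgeRepro2.T5CyclotomicFourInertPrime

section Arithmetic

variable (p : ℕ) [hp : Fact p.Prime]

/-- A prime of order `2` modulo `4` is odd (the class of `2` modulo `4` is nilpotent, of order `0`). -/
theorem not_dvd_four_of_orderOf_eq_two (h2 : orderOf (p : ZMod (2 ^ 2)) = 2) : ¬ p ∣ 2 ^ 2 := by
  intro hdvd
  have hp2 : p = 2 := (Nat.prime_dvd_prime_iff_eq hp.out Nat.prime_two).mp (hp.out.dvd_of_dvd_pow hdvd)
  rw [hp2] at h2
  have h0 : orderOf ((2 : ℕ) : ZMod (2 ^ 2)) = 0 := orderOf_eq_zero_iff'.mpr fun n hn => by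
    intro h
    have h' : ((2 : ℕ) : ZMod (2 ^ 2)) ^ n * ((2 : ℕ) : ZMod (2 ^ 2)) ^ n = 1 := by rw [h, one_mul]
    rw [← pow_add] at h'
    have hdvd2 : ((2 : ℕ) : ZMod (2 ^ 2)) ^ 2 ∣ ((2 : ℕ) : ZMod (2 ^ 2)) ^ (n + n) :=
      pow_dvd_pow _ (by omega)
    rw [h'] at hdvd2
    have hz : ((2 : ℕ) : ZMod (2 ^ 2)) ^ 2 = 0 := by decide
    rw [hz] at hdvd2
    exact absurd (zero_dvd_iff.mp hdvd2) (by decide)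
  rw [h0] at h2
  exact absurd h2 (by norm_num)

omit hp in
/-- `N((p)) = p` in `ℤ`. -/
theorem absNorm_span_natCast_int : Ideal.absNorm (Ideal.span {(p : ℤ)}) = p := by
  rw [Ideal.absNorm_span_natCast, Module.finrank_self, pow_one]

end Arithmetic

section Four

variable (K : Type*) [Field K] [CharZero K] [IsCyclotomicExtension {2 ^ 2} ℚ K]
variable (p : ℕ) [hp : Fact p.Prime] (h2 : orderOf (p : ZMod (2 ^ 2)) = 2)

omit hp in
/-- `N((p)) = p²` in `𝓞_{ℚ(i)}`. -/
theorem absNorm_span_natCast_four :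
    haveI := numberField K
    Ideal.absNorm (Ideal.span {(p : 𝓞 K)}) = p ^ 2 := by
  haveI := numberField K
  rw [Ideal.absNorm_span_natCast, RingOfIntegers.rank, finrank_rat K]

include h2 in
/-- **Every prime of `𝓞_{ℚ(i)}` above `p` has norm `p²`** when `p` has order `2` modulo `4` (Mathlib's
`IsCyclotomicExtension.Rat.inertiaDeg_eq_of_not_dvd`). -/
theorem absNorm_of_liesOver_of_orderOf_eq_two (P : Ideal (𝓞 K)) [P.IsPrime] [P.LiesOver (Ideal.span {(p : ℤ)})] :
    haveI := numberField K
    Ideal.absNorm P = p ^ 2 := by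
  haveI := numberField K
  have hf : P.inertiaDeg ℤ = 2 := by
    rw [IsCyclotomicExtension.Rat.inertiaDeg_eq_of_not_dvd (m := 2 ^ 2) p K P (not_dvd_four_of_orderOf_eq_two p h2),
      h2]
  have h := Ideal.absNorm_pow_inertiaDeg (Ideal.span {(p : ℤ)}) P
  rw [absNorm_span_natCast_int, hf] at h
  exact h.symm

include h2 in
/-- **`(p)` is a prime of `𝓞_{ℚ(i)}`** when `p` has order `2` modulo `4` (file 253's argument: `(p)` lies below a
prime above `p` and both have norm `p⁶`). -/
theorem isPrime_span_natCast_of_orderOf_eq_two :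
    haveI := numberField K
    (Ideal.span {(p : 𝓞 K)}).IsPrime := by
  haveI := numberField K
  haveI : (Ideal.span {(p : ℤ)}).IsPrime :=
    (Ideal.span_singleton_prime (Nat.cast_ne_zero.mpr hp.out.ne_zero)).mpr (Nat.prime_iff_prime_int.mp hp.out)
  obtain ⟨⟨P, hP, hPo⟩⟩ := Ideal.nonempty_primesOver (S := 𝓞 K) (Ideal.span {(p : ℤ)})
  have hle : Ideal.span {(p : 𝓞 K)} ≤ P := by
    rw [Ideal.span_le, Set.singleton_subset_iff, SetLike.mem_coe]
    have hmem : (p : ℤ) ∈ Ideal.span {(p : ℤ)} := Ideal.mem_span_singleton_self (p : ℤ)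
    rw [Ideal.mem_of_liesOver P (Ideal.span {(p : ℤ)}) p, map_natCast] at hmem
    exact hmem
  have hne : Ideal.span {(p : 𝓞 K)} ≠ ⊥ :=
    (Ideal.span_singleton_eq_bot).not.mpr (Nat.cast_ne_zero.mpr hp.out.ne_zero)
  have heq : Ideal.span {(p : 𝓞 K)} = P :=
    eq_of_le_of_absNorm_eq hle hne
      ((absNorm_span_natCast_four K p).trans (absNorm_of_liesOver_of_orderOf_eq_two K p h2 P).symm)
  rw [heq]
  exact hP

include h2 in
/-- `p` is a prime element of `𝓞_{ℚ(i)}` when it has order `6` modulo `7`. -/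
theorem prime_natCast_of_orderOf_eq_two :
    haveI := numberField K
    Prime (p : 𝓞 K) := by
  haveI := numberField K
  exact (Ideal.span_singleton_prime (Nat.cast_ne_zero.mpr hp.out.ne_zero)).mp
    (isPrime_span_natCast_of_orderOf_eq_two K p h2)

/-- **The place `(p)` of `ℚ(i)`** for a prime `p` of order `2` modulo `4`. -/
noncomputable def wPrime : HeightOneSpectrum (𝓞 K) :=
  haveI := numberField K
  { asIdeal := Ideal.span {(p : 𝓞 K)}
    isPrime := isPrime_span_natCast_of_orderOf_eq_two K p h2
    ne_bot := (Ideal.span_singleton_eq_bot).not.mpr (Nat.cast_ne_zero.mpr hp.out.ne_zero) }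

/-- The ideal of `wPrime` is `(p)`. -/
theorem wPrime_asIdeal : (wPrime K p h2).asIdeal = Ideal.span {(p : 𝓞 K)} := rfl

/-- `p ∈ wPrime`. -/
theorem natCast_mem_wPrime : (p : 𝓞 K) ∈ (wPrime K p h2).asIdeal := Ideal.mem_span_singleton_self _

omit [IsCyclotomicExtension {2 ^ 2} ℚ K] in
/-- `p ≠ 0` in `𝓞_{ℚ(i)}`. -/
theorem natCast_ne_zero' : (p : 𝓞 K) ≠ 0 := Nat.cast_ne_zero.mpr hp.out.ne_zero

/-- **The place `(p)` of `ℚ(i)⁺`**, constructed as the contraction of `wPrime`. -/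
noncomputable def vPrime : HeightOneSpectrum (𝓞 (maximalRealSubfield K)) where
  asIdeal := Ideal.comap (algebraMap (𝓞 (maximalRealSubfield K)) (𝓞 K)) (wPrime K p h2).asIdeal
  isPrime := Ideal.IsPrime.comap _
  ne_bot := Ideal.comap_ne_bot_of_integral_mem (natCast_ne_zero' K p) (natCast_mem_wPrime K p h2)
    (Algebra.IsIntegral.isIntegral _)

/-- The ideal of `vPrime` is the contraction of `(p)`. -/
theorem vPrime_asIdeal :
    (vPrime K p h2).asIdeal =
      Ideal.comap (algebraMap (𝓞 (maximalRealSubfield K)) (𝓞 K)) (wPrime K p h2).asIdeal :=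
  rfl

/-- `p ∈ vPrime`. -/
theorem natCast_mem_vPrime : (p : 𝓞 (maximalRealSubfield K)) ∈ (vPrime K p h2).asIdeal := by
  rw [vPrime_asIdeal, Ideal.mem_comap, map_natCast]
  exact natCast_mem_wPrime K p h2

/-- `wPrime` lies over `vPrime`. -/
instance liesOver_vPrime : (wPrime K p h2).asIdeal.LiesOver (vPrime K p h2).asIdeal := ⟨rfl⟩

/-- **`p` stays prime in `ℚ(i)`, from `ℚ(i)⁺`**: `(p) 𝓞_K = (p)` — the hypothesis `hmap` of files 233 / 236 at
every such place. -/
theorem map_vPrime :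
    Ideal.map (algebraMap (𝓞 (maximalRealSubfield K)) (𝓞 K)) (vPrime K p h2).asIdeal =
      (wPrime K p h2).asIdeal := by
  refine le_antisymm Ideal.map_comap_le ?_
  rw [wPrime_asIdeal, Ideal.span_le, Set.singleton_subset_iff]
  have h := Ideal.mem_map_of_mem (algebraMap (𝓞 (maximalRealSubfield K)) (𝓞 K)) (natCast_mem_vPrime K p h2)
  rwa [map_natCast] at h

/-- **`N(vPrime) = p`**: `N(w) = N(v)²` (file 207's `absNorm_eq_sq`, `e = 1` and `[K_w : K⁺_v] = 2` from
«stays prime») and `N(w) = p²`. -/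
theorem absNorm_vPrime :
    haveI := numberField K; haveI := isCMField_four K
    Ideal.absNorm (vPrime K p h2).asIdeal = p := by
  haveI := numberField K
  haveI := isCMField_four K
  have he := ramificationIdx'_eq_one_of_staysPrime (vPrime K p h2) (wPrime K p h2) (map_vPrime K p h2)
  obtain ⟨θ, y, hθ, hy⟩ := exists_sq_eq_and_complexConj_ne K
  have hf := finrank_eq_two K (vPrime K p h2) (wPrime K p h2) hθ hy
    (not_isSquare_of_staysPrime K (vPrime K p h2) (wPrime K p h2) hθ hy (map_vPrime K p h2))
  have h := absNorm_eq_sq (vPrime K p h2) (wPrime K p h2) he hf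
  rw [wPrime_asIdeal, absNorm_span_natCast_four K p] at h
  exact (Nat.pow_left_injective two_ne_zero h).symm

end Four

section Instances

variable (K : Type*) [Field K] [CharZero K] [IsCyclotomicExtension {2 ^ 2} ℚ K]

/-- `3` has multiplicative order `2` modulo `4`. -/
theorem orderOf_natCast_three_zmod_four : orderOf ((3 : ℕ) : ZMod (2 ^ 2)) = 2 := by
  rw [orderOf_eq_iff (by norm_num)]
  decide

/-- `7` has multiplicative order `2` modulo `4`. -/
theorem orderOf_natCast_seven_zmod_four : orderOf ((7 : ℕ) : ZMod (2 ^ 2)) = 2 := by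
  rw [orderOf_eq_iff (by norm_num)]
  decide

/-- `7` is prime (as a `Fact`, for the generic theorems). -/
theorem fact_prime_seven : Fact (Nat.Prime 7) := ⟨by norm_num⟩

/-- **`(3)` is a prime of `𝓞_{ℚ(i)}`** (seat p8's T5-160 by Kummer–Dedekind; here by the inertia degree). -/
theorem isPrime_span_three :
    haveI := numberField K
    (Ideal.span {(3 : 𝓞 K)}).IsPrime := by
  haveI := numberField K
  have h := isPrime_span_natCast_of_orderOf_eq_two K 3 orderOf_natCast_three_zmod_four
  rwa [Nat.cast_ofNat] at h

/-- **`(7)` is a prime of `𝓞_{ℚ(i)}`.** -/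
theorem isPrime_span_seven :
    haveI := numberField K; haveI := fact_prime_seven
    (Ideal.span {(7 : 𝓞 K)}).IsPrime := by
  haveI := numberField K
  haveI := fact_prime_seven
  have h := isPrime_span_natCast_of_orderOf_eq_two K 7 orderOf_natCast_seven_zmod_four
  rwa [Nat.cast_ofNat] at h

/-- **`N(vPrime 7) = 7`**: the place `(7)` of `ℚ(i)⁺` stays prime in `ℚ(i)` with `q = 7`. -/
theorem absNorm_vPrime_seven :
    haveI := numberField K; haveI := isCMField_four K; haveI := fact_prime_seven
    Ideal.absNorm (vPrime K 7 orderOf_natCast_seven_zmod_four).asIdeal = 7 := by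
  haveI := numberField K
  haveI := isCMField_four K
  haveI := fact_prime_seven
  exact absNorm_vPrime K 7 orderOf_natCast_seven_zmod_four

end Instances

end Summit.Ventures.HodgeRepro2.T5CyclotomicFourInertPrime
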